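import Mathlib.Algebra.Algebra.Subalgebra.Basic
import Mathlib.Algebra.Algebra.Tower
import Mathlib.Algebra.Module.Submodule.Basic
import Mathlib.Algebra.Module.Torsion.Field
import Mathlib.Algebra.Module.Torsion.Free
import Mathlib.Algebra.Ring.NonZeroDivisors
import HarnessLib

/-!
# Linear maps between modules over a birational extension are linear over the bigger ring

Topic: `Literature/RingTheory/Localization`. Let `R → S` be a ring map which is *birational* in
the weak sense that every `s ∈ S` satisfies `b · s = r · 1` in `S` for some non-zero-divisor
`b ∈ R⁰` and some `r ∈ R` — e.g. `R ⊆ S ⊆ Frac R`: a finite birational extension, the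
normalisation of a domain, an affine blow-up chart, a localisation at non-zero-divisors. If `M`,
`N` are `S`-modules and `N` is torsion-free as an `R`-module (non-zero-divisors of `R` act
injectively), then every `R`-linear map `f : M → N` is automatically `S`-linear: for `s ∈ S` and
`b s = r`, `b • f (s • m) = f ((b s) • m) = f (r • m) = r • f m = (b s) • f m = b • (s • f m)`, and
`b` is `N`-regular. This is the lemma behind `Hom_R(M, N) = Hom_S(M, N)` for a finite birational
extension `R ⊆ S` and `S`-modules `M`, `N` with `N` torsion-free (Leuschke–Wiegand,
*Cohen–Macaulay representations* (2012), Ch. 4; Bass, *On the ubiquity of Gorenstein rings*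
(1963), §7), used constantly for one-dimensional rings and in conductor arguments
(`End_R(S) = S`, `Hom_R(S, R) ≅ 𝔠_{S/R}`).

* `LinearMap.map_smul_of_isBirational` — the statement above, with torsion-freeness as the
  explicit hypothesis `∀ b ∈ R⁰, ∀ n, b • n = 0 → n = 0`;
* `Module.isTorsionFree_iff_forall_mem_nonZeroDivisors` — that hypothesis is Mathlib's class
  `Module.IsTorsionFree R N`; `LinearMap.map_smul_of_isBirational_of_isTorsionFree` — the class
  form of the main statement;
* `LinearMap.exists_restrictScalars_eq_of_isBirational`,
  `LinearMap.restrictScalars_bijective_of_isBirational` — the bundled form: restriction of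
  scalars `(M →ₗ[S] N) → (M →ₗ[R] N)` is a bijection, i.e. `Hom_S(M, N) = Hom_R(M, N)`;
* the case of two subalgebras `B`, `C` of a field `K` (over a base ring `k`) with `C ⊆ Frac B`
  inside `K`, i.e. `∀ s ∈ C, ∃ b ∈ B, b ≠ 0 ∧ b * s ∈ B`, for any algebra structure `↥B → ↥C`
  compatible with the two inclusions into `K` (`IsScalarTower ↥B ↥C K`):
  `Subalgebra.coe_smul_eq_mul`, `Subalgebra.isScalarTower_inclusion` (the inclusion of `B ≤ C` is
  such a structure), `Subalgebra.isScalarTower_module` (`K`-vector spaces are `↥B`-`↥C`-towers),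
  `Subalgebra.exists_mem_nonZeroDivisors_mul_eq` (the birationality hypothesis),
  `Subalgebra.isTorsionFree_left`, `Subalgebra.isTorsionFree_submodule` (vector spaces and
  `↥C`-submodules of vector spaces are torsion-free over `↥B`), and finally
  **`LinearMap.map_smul_of_forall_exists_mul_mem`**: a `↥B`-linear map from a `↥C`-module into a
  `↥C`-submodule of a `K`-vector space is `↥C`-linear;
  `LinearMap.map_smul_of_le_of_forall_exists_mul_mem` — the same for a bare inclusion `B ≤ C`,
  between `↥C`-submodules of two `K`-vector spaces, with the instances spelled out.

Usage with a bare inequality `h : B ≤ C` of subalgebras: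
`letI := (Subalgebra.inclusion h).toRingHom.toAlgebra`,
`haveI := Subalgebra.isScalarTower_inclusion h`, and, for each ambient `K`-vector space `V`,
`haveI := Subalgebra.isScalarTower_module (B := B) (C := C) V` (this makes `↥C`-submodules of `V`
into `↥B`-modules through `Submodule.module'`).

The special case where `S` is literally a localisation of `R` — then no torsion-freeness is
needed — is Mathlib's `IsLocalization.linearMap_compatibleSMul` /
`LinearMap.extendScalarsOfIsLocalization` (`Mathlib.RingTheory.Localization.Module`); a birational
`S` such as the normalisation of `R` is in general not a localisation of `R`, whence this file.
Deliberately NOT here: the bundled `S`-linear map as a `def` (obtain it from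
`LinearMap.exists_restrictScalars_eq_of_isBirational`, or as the inverse of the bijection
`LinearMap.restrictScalars_bijective_of_isBirational`), and the ring-theoretic consequences
(`End_R(S) = S`, conductor formulas).
-/

namespace Literature.RingTheory.Localization

open scoped nonZeroDivisors

section General

/-- **Torsion-free means no torsion by non-zero-divisors.** For a ring `R` and an `R`-module `N`
(an additive group), Mathlib's `Module.IsTorsionFree R N` (regular elements of `R` act injectively
on `N`) is equivalent to: `b • n = 0 → n = 0` for every non-zero-divisor `b ∈ R⁰` and every
`n : N`. [folklore] -/
theorem Module.isTorsionFree_iff_forall_mem_nonZeroDivisors {R N : Type*} [Ring R]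
    [AddCommGroup N] [Module R N] :
    Module.IsTorsionFree R N ↔ ∀ b ∈ R⁰, ∀ n : N, b • n = 0 → n = 0 := by
  constructor
  · intro _ b hb n hn
    exact (isRegular_iff_mem_nonZeroDivisors.mpr hb).smul_eq_zero_iff_right.mp hn
  · intro h
    refine ⟨fun b hb n₁ n₂ h12 => sub_eq_zero.mp (h b hb.mem_nonZeroDivisors _ ?_)⟩
    rw [smul_sub, sub_eq_zero]
    exact h12

/-- **`R`-linear maps into a torsion-free module are linear over a birational extension of `R`.**
Let `R → S` be a ring map such that every `s : S` satisfies `b · s = r` in `S` for some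
non-zero-divisor `b ∈ R⁰` and some `r ∈ R` (`S ⊆ "Frac R"`: a finite birational extension, the
normalisation, a blow-up chart, …), let `M`, `N` be `S`-modules with the induced
`R`-module structures, and assume `N` is torsion-free over `R` (`b • n = 0 → n = 0` for
`b ∈ R⁰`). Then every `R`-linear map `f : M → N` commutes with the `S`-actions:
`f (s • m) = s • f m`. Proof: with
`b s = r`, `b • f (s • m) = f ((b s) • m) = f (r • m) = r • f m = (b s) • f m = b • (s • f m)`,
and `b` acts injectively on `N`. This is the lemma behind `Hom_R(M, N) = Hom_S(M, N)` for a
finite birational extension `R ⊆ S` (Leuschke–Wiegand, *Cohen–Macaulay representations* (2012),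
Ch. 4; Bass 1963, §7); the case `S = U⁻¹R` a localisation (no torsion-freeness needed) is
Mathlib's `IsLocalization.linearMap_compatibleSMul` / `LinearMap.extendScalarsOfIsLocalization`.
[folklore] -/
theorem LinearMap.map_smul_of_isBirational {R S : Type*} [CommRing R] [CommRing S] [Algebra R S]
    (hbir : ∀ s : S, ∃ b : R, b ∈ nonZeroDivisors R ∧ ∃ r : R,
      algebraMap R S b * s = algebraMap R S r)
    {M N : Type*} [AddCommGroup M] [Module S M] [Module R M] [IsScalarTower R S M]
    [AddCommGroup N] [Module S N] [Module R N] [IsScalarTower R S N]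
    (htf : ∀ b ∈ nonZeroDivisors R, ∀ n : N, b • n = 0 → n = 0)
    (f : M →ₗ[R] N) (s : S) (m : M) : f (s • m) = s • f m := by
  obtain ⟨b, hb, r, hr⟩ := hbir s
  refine sub_eq_zero.mp (htf b hb _ ?_)
  rw [smul_sub, sub_eq_zero]
  calc b • f (s • m) = f (b • s • m) := (f.map_smul b (s • m)).symm
    _ = f ((algebraMap R S b * s) • m) := by rw [mul_smul, algebraMap_smul]
    _ = f (r • m) := by rw [hr, algebraMap_smul]
    _ = r • f m := f.map_smul r m
    _ = (algebraMap R S b * s) • f m := by rw [hr, algebraMap_smul]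
    _ = b • s • f m := by rw [mul_smul, algebraMap_smul]

/-- **Class form.** For a birational ring map `R → S` (every `s : S` has `b · s = r` with
`b ∈ R⁰`, `r ∈ R`), `S`-modules `M`, `N` with `N` torsion-free over `R` in the sense of Mathlib's
`Module.IsTorsionFree R N`, every `R`-linear `f : M → N` satisfies `f (s • m) = s • f m`
(Leuschke–Wiegand 2012, Ch. 4). [folklore] -/
theorem LinearMap.map_smul_of_isBirational_of_isTorsionFree {R S : Type*} [CommRing R]
    [CommRing S] [Algebra R S]
    (hbir : ∀ s : S, ∃ b : R, b ∈ nonZeroDivisors R ∧ ∃ r : R,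
      algebraMap R S b * s = algebraMap R S r)
    {M N : Type*} [AddCommGroup M] [Module S M] [Module R M] [IsScalarTower R S M]
    [AddCommGroup N] [Module S N] [Module R N] [IsScalarTower R S N] [Module.IsTorsionFree R N]
    (f : M →ₗ[R] N) (s : S) (m : M) : f (s • m) = s • f m :=
  LinearMap.map_smul_of_isBirational hbir
    (Module.isTorsionFree_iff_forall_mem_nonZeroDivisors.mp ‹_›) f s m

/-- **Bundled form: every `R`-linear map is the restriction of an `S`-linear map.** For a
birational ring map `R → S` and `S`-modules `M`, `N` with `N` torsion-free over `R`, every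
`R`-linear `f : M → N` is `g.restrictScalars R` for an (automatically unique) `S`-linear
`g : M → N` — namely `f` itself with `LinearMap.map_smul_of_isBirational_of_isTorsionFree` as its
`S`-linearity (Leuschke–Wiegand 2012, Ch. 4: `Hom_R(M, N) = Hom_S(M, N)`). [folklore] -/
theorem LinearMap.exists_restrictScalars_eq_of_isBirational {R S : Type*} [CommRing R]
    [CommRing S] [Algebra R S]
    (hbir : ∀ s : S, ∃ b : R, b ∈ nonZeroDivisors R ∧ ∃ r : R,
      algebraMap R S b * s = algebraMap R S r)
    {M N : Type*} [AddCommGroup M] [Module S M] [Module R M] [IsScalarTower R S M]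
    [AddCommGroup N] [Module S N] [Module R N] [IsScalarTower R S N] [Module.IsTorsionFree R N]
    (f : M →ₗ[R] N) : ∃ g : M →ₗ[S] N, g.restrictScalars R = f :=
  ⟨{ toFun := f
     map_add' := f.map_add
     map_smul' := LinearMap.map_smul_of_isBirational_of_isTorsionFree hbir f },
    LinearMap.ext fun _ => rfl⟩

/-- **`Hom_S(M, N) = Hom_R(M, N)` over a birational extension.** For a birational ring map
`R → S` (every `s : S` has `b · s = r` with `b ∈ R⁰`, `r ∈ R`) and `S`-modules `M`, `N` with `N`
torsion-free over `R`, restriction of scalars `(M →ₗ[S] N) → (M →ₗ[R] N)` is a bijection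
(injective always; surjective by `LinearMap.exists_restrictScalars_eq_of_isBirational`).
Leuschke–Wiegand, *Cohen–Macaulay representations* (2012), Ch. 4. [folklore] -/
theorem LinearMap.restrictScalars_bijective_of_isBirational {R S : Type*} [CommRing R]
    [CommRing S] [Algebra R S]
    (hbir : ∀ s : S, ∃ b : R, b ∈ nonZeroDivisors R ∧ ∃ r : R,
      algebraMap R S b * s = algebraMap R S r)
    (M N : Type*) [AddCommGroup M] [Module S M] [Module R M] [IsScalarTower R S M]
    [AddCommGroup N] [Module S N] [Module R N] [IsScalarTower R S N] [Module.IsTorsionFree R N] :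
    Function.Bijective (LinearMap.restrictScalars R : (M →ₗ[S] N) → M →ₗ[R] N) :=
  ⟨LinearMap.restrictScalars_injective R,
    fun f => LinearMap.exists_restrictScalars_eq_of_isBirational hbir f⟩

end General

/-! ### Subalgebras of a field: `B ≤ C ⊆ K` with `C ⊆ Frac B` -/

section Subalgebra

variable {k K : Type*} [CommRing k] [Field K] [Algebra k K] {B C : Subalgebra k K}

/-- For subalgebras `B`, `C` of a field `K` and an action `↥B → ↥C` compatible with the two
inclusions into `K` (`IsScalarTower ↥B ↥C K`), the action is multiplication inside `K`:
`↑(b • c) = ↑b * ↑c`. [folklore] -/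
theorem Subalgebra.coe_smul_eq_mul [SMul B C] [IsScalarTower B C K] (b : B) (c : C) :
    ((b • c : C) : K) = (b : K) * (c : K) := by
  simpa only [Subalgebra.smul_def, smul_eq_mul, mul_one] using smul_assoc b c (1 : K)

/-- For subalgebras `B ≤ C` of a field `K`, the inclusion `↥B →ₐ ↥C`, taken as the
`Algebra ↥B ↥C` structure, is compatible with the two inclusions into `K`
(`IsScalarTower ↥B ↥C K`). [folklore] -/
theorem Subalgebra.isScalarTower_inclusion (h : B ≤ C) :
    letI := (Subalgebra.inclusion h).toRingHom.toAlgebra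
    IsScalarTower B C K :=
  letI := (Subalgebra.inclusion h).toRingHom.toAlgebra
  IsScalarTower.of_algebraMap_eq fun _ => rfl

/-- For subalgebras `B`, `C` of a field `K` with an action `↥B → ↥C` compatible with the
inclusions into `K`, every `K`-vector space `V` is a `↥B`-`↥C`-tower:
`(b • c) • v = b • (c • v)` (both sides are `(↑b * ↑c) • v`). In particular `↥C`-submodules of `V`
are `↥B`-modules (`Submodule.module'`). [folklore] -/
theorem Subalgebra.isScalarTower_module [SMul B C] [IsScalarTower B C K]
    (V : Type*) [AddCommGroup V] [Module K V] : IsScalarTower B C V :=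
  ⟨fun b c v => by
    simp only [Subalgebra.smul_def, Subalgebra.coe_smul_eq_mul, mul_smul]⟩

/-- **The birationality hypothesis for subalgebras of a field.** Let `B`, `C` be subalgebras of a
field `K` with an algebra structure `↥B → ↥C` compatible with the inclusions into `K`, and assume
`C ⊆ Frac B` inside `K`: every `s ∈ C` has `b * s ∈ B` for some non-zero `b ∈ B`. Then every
`s : ↥C` satisfies `b · s = r` in `↥C` for some non-zero-divisor `b` of `↥B` and some `r : ↥B` —
the hypothesis of `LinearMap.map_smul_of_isBirational`. [folklore] -/
theorem Subalgebra.exists_mem_nonZeroDivisors_mul_eq [Algebra B C] [IsScalarTower B C K]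
    (hfrac : ∀ s ∈ C, ∃ b ∈ B, b ≠ 0 ∧ b * s ∈ B) (s : C) :
    ∃ b : B, b ∈ nonZeroDivisors B ∧ ∃ r : B, algebraMap B C b * s = algebraMap B C r := by
  obtain ⟨b, hbB, hb0, hbs⟩ := hfrac s s.2
  refine ⟨⟨b, hbB⟩, mem_nonZeroDivisors_of_ne_zero ?_, ⟨b * s, hbs⟩, Subtype.ext ?_⟩
  · exact fun h => hb0 (congrArg Subtype.val h)
  · simp only [Algebra.algebraMap_eq_smul_one, MulMemClass.coe_mul, Subalgebra.coe_smul_eq_mul,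
      OneMemClass.coe_one, mul_one]

/-- Over a subalgebra `B` of a field `K`, every `K`-vector space is a torsion-free `↥B`-module
(non-zero elements of `B` are units of `K`). [folklore] -/
theorem Subalgebra.isTorsionFree_left (B : Subalgebra k K) (W : Type*) [AddCommGroup W]
    [Module K W] : Module.IsTorsionFree B W :=
  Module.IsTorsionFree.trans K

/-- For subalgebras `B`, `C` of a field `K` with a compatible action `↥B → ↥C`, a `↥C`-submodule
`Z` of a `K`-vector space `W`, with `↥B` acting through `↥C`, is a torsion-free `↥B`-module.
[folklore] -/
theorem Subalgebra.isTorsionFree_submodule [SMul B C] {W : Type*} [AddCommGroup W] [Module K W]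
    [IsScalarTower B C W] (Z : Submodule C W) : Module.IsTorsionFree B Z :=
  haveI := Subalgebra.isTorsionFree_left B W
  Subtype.val_injective.moduleIsTorsionFree (Subtype.val : Z → W) fun _ _ => rfl

/-- **Linear maps over a birational extension of subalgebras of a field.** Let `B`, `C` be
subalgebras of a field `K` (over a base ring `k`) with an algebra structure `↥B → ↥C` compatible
with the inclusions into `K` (e.g. the inclusion of `B ≤ C`, `Subalgebra.isScalarTower_inclusion`),
and assume `C ⊆ Frac B` inside `K`: `∀ s ∈ C, ∃ b ∈ B, b ≠ 0 ∧ b * s ∈ B` (e.g. `C` a finite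
birational extension, the normalisation, or a blow-up chart of `B`). Let `M` be a `↥C`-module
(with a compatible `↥B`-structure) and `Z` a `↥C`-submodule of a `K`-vector space `W` (a
`↥B`-module through `↥C`; such `Z` are exactly the torsion-free `↥C`-modules up to isomorphism).
Then every `↥B`-linear map `f : M → Z` is `↥C`-linear: `f (s • m) = s • f m`. Leuschke–Wiegand,
*Cohen–Macaulay representations* (2012), Ch. 4 (`Hom_B(M, Z) = Hom_C(M, Z)`). [folklore] -/
theorem LinearMap.map_smul_of_forall_exists_mul_mem [Algebra B C] [IsScalarTower B C K]
    (hfrac : ∀ s ∈ C, ∃ b ∈ B, b ≠ 0 ∧ b * s ∈ B)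
    {M : Type*} [AddCommGroup M] [Module C M] [Module B M] [IsScalarTower B C M]
    {W : Type*} [AddCommGroup W] [Module K W] [IsScalarTower B C W]
    (Z : Submodule C W) (f : M →ₗ[B] Z) (s : C) (m : M) : f (s • m) = s • f m :=
  haveI : Module.IsTorsionFree B Z := Subalgebra.isTorsionFree_submodule Z
  LinearMap.map_smul_of_isBirational_of_isTorsionFree (R := B) (S := C)
    (Subalgebra.exists_mem_nonZeroDivisors_mul_eq hfrac) f s m

/-- **The same for a bare inclusion `B ≤ C` of subalgebras of a field** (the instance plumbing
made explicit). For subalgebras `B ≤ C` of a field `K` with `C ⊆ Frac B` inside `K`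
(`∀ s ∈ C, ∃ b ∈ B, b ≠ 0 ∧ b * s ∈ B`) and `↥C`-submodules `Y ⊆ V`, `Z ⊆ W` of `K`-vector spaces,
viewed as `↥B`-modules through the inclusion `↥B → ↥C` (`Subalgebra.inclusion` as the
`Algebra ↥B ↥C` structure; the towers `IsScalarTower ↥B ↥C V`, `IsScalarTower ↥B ↥C W` are
`Subalgebra.isScalarTower_module`), every `↥B`-linear `f : Y → Z` is `↥C`-linear. To use it, put
the same three instances in context (`letI := (Subalgebra.inclusion h).toRingHom.toAlgebra`,
`haveI := Subalgebra.isScalarTower_inclusion h`,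
`haveI := Subalgebra.isScalarTower_module (B := B) (C := C) V`, and the same for `W`).
Leuschke–Wiegand 2012, Ch. 4. [folklore] -/
theorem LinearMap.map_smul_of_le_of_forall_exists_mul_mem (h : B ≤ C)
    (hfrac : ∀ s ∈ C, ∃ b ∈ B, b ≠ 0 ∧ b * s ∈ B)
    {V W : Type*} [AddCommGroup V] [Module K V] [AddCommGroup W] [Module K W]
    (Y : Submodule C V) (Z : Submodule C W) :
    letI := (Subalgebra.inclusion h).toRingHom.toAlgebra
    haveI := Subalgebra.isScalarTower_inclusion h
    haveI := Subalgebra.isScalarTower_module (B := B) (C := C) V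
    haveI := Subalgebra.isScalarTower_module (B := B) (C := C) W
    ∀ (f : Y →ₗ[B] Z) (s : C) (y : Y), f (s • y) = s • f y :=
  letI := (Subalgebra.inclusion h).toRingHom.toAlgebra
  haveI := Subalgebra.isScalarTower_inclusion h
  haveI := Subalgebra.isScalarTower_module (B := B) (C := C) V
  haveI := Subalgebra.isScalarTower_module (B := B) (C := C) W
  fun f s y => LinearMap.map_smul_of_forall_exists_mul_mem hfrac Z f s y

end Subalgebra

end Literature.RingTheory.Localization
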